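import Summits.Ventures.PercRepro.RankLevelSetUpFiveSort

/-! # RankLevelSetUpFiveSeries — (↑) AT LEVEL `5` ALONG A SERIES CLASS OF SIZE `≥ 3` FROM THE INDUCTIVE HYPOTHESIS
AND THE NAMED RESIDUE (C1) (night-1 g39; dossier §51.8–51.10; on `RankLevelSetUpFiveSort`)

For `M` coloop-free of nullity `4` with a series class `P = cl✶ {p}` of `q ≥ 3` elements, `b ∉ P` and `#E' ≥ 9`:
a class of `q ≥ 4` elements is cut to three (`M ／ (P ∖ {p, p', p''})`, fewer elements, so (↑)₅ there is the
inductive hypothesis) and `T_5(N) = T_5(N⁽³⁾) + (q − 3) g_4 + (C(q,2) − 3) g_3 ≤ V_6(N⁽³⁾) + … ≤ Ā_6 + q ḡ_5 +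
C(q,2) ḡ_4 + ḡ_3 ≤ V_6(N)` with `g_4 ≤ ḡ_5`, `g_3 ≤ ḡ_4`; a class of exactly three elements is cut to two
(`#E'' = #E' + 2 ≥ 11`: the inductive hypothesis, or the exact middle when `#E'' = 11`) and
`T_5(N) + g_3^{sp} = T_5(N''') + g_4 + 3 g_3 ≤ V_6(N''') + g_4 + 3 g_3 = Ā_6 + 2 ḡ_5 + ḡ_4^{sp} + g_4 + 3 g_3 ≤
Ā_6 + 3 ḡ_5 + 3 ḡ_4 + ḡ_3^{sp} + g_3^{sp} = V_6(N) + g_3^{sp}` with **`UpFiveResidue`** (C1) absorbing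
`ḡ_4^{sp} + g_3`. Hence **`upAt_five_of_seriesClass_of_residue`**. Every declaration has a docstring; imports:
the cell's own modules and Mathlib only. Axioms: standard. -/

namespace PercRepro

open Set Matroid

variable {α : Type} (M : Matroid α) [M.Finite]

/-- **(↑) at the exact middle `#E = 2k + 1` is the complementation identity.** -/
lemma upAt_of_ncard_eq_middle {b : α} (hb : b ∈ M.E) {k : ℕ} (hn : M.E.ncard = 2 * k + 1) :
    BiIndepUpAt M b k := by
  rw [upAt_iff_through_le_through M hb (by omega), hn]
  have e : 2 * k + 1 - 1 - k = k := by omega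
  rw [e]

/-- **(↑) AT LEVEL `5` ALONG A SERIES CLASS OF SIZE `≥ 3`, FROM (↑) AT LEVEL `5` ON THE MATROIDS WITH FEWER
ELEMENTS AND THE RESIDUE (C1) OF THE CLASS OF SIZE THREE** (`M` coloop-free of nullity `4`, `p ∈ E` with
`q = #cl✶ {p} ≥ 3`, `b ∉ cl✶ {p}`, `9 ≤ #E'`). -/
theorem upAt_five_of_seriesClass_of_residue (hcol : ∀ e, ¬ M.IsColoop e) (hν : M✶.eRank = 4) {p : α}
    (hp : p ∈ M.E) (hq : 3 ≤ (M✶.closure {p}).ncard) {b : α} (hb : b ∈ M.E) (hbP : b ∉ M✶.closure {p})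
    (h9 : 9 ≤ (M.E \ M✶.closure {p}).ncard)
    (hih : ∀ (M' : Matroid α) [M'.Finite], M'.E.ncard < M.E.ncard → M'✶.eRank ≤ 4 → 12 ≤ M'.E.ncard →
      ∀ b ∈ M'.E, BiIndepUpAt M' b 5)
    (hres : (M✶.closure {p}).ncard = 3 → UpFiveResidue M✶ p b) :
    BiIndepUpAt M b 5 := by
  classical
  have hnl := dual_isNonloop_of_coloopFree' M hcol
  have hpE : p ∈ M✶.E := by rwa [Matroid.dual_ground]
  have hbE : b ∈ M✶.E := by rwa [Matroid.dual_ground]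
  have hPE : M✶.closure {p} ⊆ M✶.E := M✶.closure_subset_ground _
  have hpP : p ∈ M✶.closure {p} := M✶.mem_closure_of_mem' rfl hpE
  have hPfin : (M✶.closure {p}).Finite := M✶.ground_finite.subset hPE
  have hE'card : (M✶.E \ M✶.closure {p}).ncard + (M✶.closure {p}).ncard = M.E.ncard := by
    rw [Set.ncard_sdiff hPE (M.ground_finite.subset hPE), Matroid.dual_ground]
    have := Set.ncard_le_ncard hPE M.ground_finite
    rw [Matroid.dual_ground] at this
    omega
  have h9' : 9 ≤ (M✶.E \ M✶.closure {p}).ncard := by rw [Matroid.dual_ground]; exact h9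
  -- the two inequalities of the contraction
  have hg3 := throughHat_three_le_avoidHat_four M hcol hν hp hb hbP (by omega)
  have hg4 : (throughHat M✶ p b 4).ncard ≤ (avoidHat M✶ p b 5).ncard := by
    rcases Nat.lt_or_ge (M✶.E \ M✶.closure {p}).ncard 10 with h9'' | h10
    · have h9e : (M✶.E \ M✶.closure {p}).ncard = 9 := by omega
      rw [avoidHat_ncard_eq_throughHat_compl M✶ hbE hbP (k := 5) (by omega), h9e]
    · refine throughHat_four_le_avoidHat_five M hcol hν hp hb hbP ?_
      have h10' := h10
      rw [Matroid.dual_ground] at h10'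
      exact h10'
  unfold BiIndepUpAt
  rw [biIndep_eq_biSpan_dual, biIndep_eq_biSpan_dual]
  -- the generic cut: `D ⊆ P ∖ {p}`, the class cut to `P ∖ D`
  have hcut : ∀ (D : Set α), D ⊆ M✶.closure {p} → p ∉ D → D.Nonempty →
      (M.contract D)✶ = M✶.delete D ∧ (M.contract D).E.ncard = M.E.ncard - D.ncard ∧
      (M.contract D).E.ncard < M.E.ncard ∧ (M.contract D)✶.eRank ≤ 4 ∧ b ∈ (M.contract D).E ∧
      (M✶.delete D).closure {p} = M✶.closure {p} \ D := by
    intro D hDP hpD hDne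
    have hDE : D ⊆ M.E := by rw [← Matroid.dual_ground (M := M)]; exact hDP.trans hPE
    have hDfin : D.Finite := hPfin.subset hDP
    have hco : M✶.Coindep D := coindep_of_subset_closure_of_notMem M✶ hpE hDP hpD
    have hdual : (M.contract D)✶ = M✶.delete D := Matroid.dual_contract M D
    have hcard : (M.contract D).E.ncard = M.E.ncard - D.ncard := by
      rw [Matroid.contract_ground, Set.ncard_sdiff hDE hDfin]
    refine ⟨hdual, hcard, ?_, ?_, ?_, ?_⟩
    · rw [hcard]
      have := Set.ncard_le_ncard hDE M.ground_finite
      have hpos : 0 < D.ncard := (Set.ncard_pos hDfin).mpr hDne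
      omega
    · rw [hdual, eRank_delete_of_coindep M✶ hco, hν]
    · rw [Matroid.contract_ground]; exact ⟨hb, fun h => hbP (hDP h)⟩
    · rw [Matroid.delete_closure_eq_of_disjoint M✶ (Set.disjoint_singleton_left.mpr hpD)]
  -- the cut dual is loopless of rank `4` with `p`, and `b` outside its class
  have hfam : ∀ (D : Set α), D ⊆ M✶.closure {p} → p ∉ D →
      (∀ e ∈ (M✶.delete D).E, (M✶.delete D).IsNonloop e) ∧ (M✶.delete D).eRank = 4 ∧ p ∈ (M✶.delete D).E ∧
      b ∉ (M✶.delete D).closure {p} := by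
    intro D hDP hpD
    have hco : M✶.Coindep D := coindep_of_subset_closure_of_notMem M✶ hpE hDP hpD
    refine ⟨?_, by rw [eRank_delete_of_coindep M✶ hco, hν], ?_, ?_⟩
    · intro e he
      rw [Matroid.delete_ground] at he
      exact Matroid.delete_isNonloop_iff.mpr ⟨hnl e he.1, he.2⟩
    · rw [Matroid.delete_ground]; exact ⟨hpE, hpD⟩
    · rw [Matroid.delete_closure_eq_of_disjoint M✶ (Set.disjoint_singleton_left.mpr hpD)]
      exact fun h => hbP h.1
  -- a second element of the class
  obtain ⟨p', hp'⟩ : (M✶.closure {p} \ {p}).Nonempty := by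
    refine Set.nonempty_of_ncard_ne_zero ?_
    rw [Set.ncard_sdiff_singleton_of_mem hpP]; omega
  have hp'P : p' ∈ M✶.closure {p} := hp'.1
  have hp'p : p' ≠ p := fun h => hp'.2 (by rw [Set.mem_singleton_iff]; exact h)
  have hpair : ({p, p'} : Set α) ⊆ M✶.closure {p} := by
    intro x hx; rcases hx with rfl | hx
    · exact hpP
    · rw [Set.mem_singleton_iff] at hx; rw [hx]; exact hp'P
  -- the decomposition of `T_5(M✶)`
  have hT := through_five_eq_of_three_le M✶ hnl hν hpE hq hbP
  rcases Nat.lt_or_ge (M✶.closure {p}).ncard 4 with hq3 | hq4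
  · -- `q = 3`: cut to two and use the residue
    have hq3' : (M✶.closure {p}).ncard = 3 := by omega
    have hV := avoid_six_eq_of_three M✶ hnl hν hpE hq3' hbP
    have hC1 := hres hq3'
    unfold UpFiveResidue at hC1
    set D := M✶.closure {p} \ {p, p'} with hDdef
    have hDP : D ⊆ M✶.closure {p} := Set.sdiff_subset
    have hpD : p ∉ D := fun h => h.2 (Set.mem_insert p {p'})
    have hDcard : D.ncard = 1 := by
      rw [hDdef, Set.ncard_sdiff hpair (Set.toFinite _), Set.ncard_pair hp'p.symm, hq3']
    have hDne : D.Nonempty := Set.nonempty_of_ncard_ne_zero (by rw [hDcard]; norm_num)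
    obtain ⟨hdual, hcard, hlt, hν', hbM, hcl⟩ := hcut D hDP hpD hDne
    obtain ⟨hnl', hr', hp'', hbP'⟩ := hfam D hDP hpD
    have hcl2 : ((M✶.delete D).closure {p}).ncard = 2 := by
      rw [hcl, hDdef, Set.sdiff_sdiff_cancel_left hpair, Set.ncard_pair hp'p.symm]
    -- (↑)₅ of the cut matroid: the inductive hypothesis, or the exact middle
    haveI : (M.contract D).Finite := Matroid.contract_finite
    have hup0 : BiIndepUpAt (M.contract D) b 5 := by
      rcases Nat.lt_or_ge (M.contract D).E.ncard 12 with h11 | h12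
      · refine upAt_of_ncard_eq_middle (M.contract D) hbM ?_
        rw [hcard, hDcard]; omega
      · exact hih (M.contract D) hlt hν' h12 b hbM
    unfold BiIndepUpAt at hup0
    rw [biIndep_eq_biSpan_dual, biIndep_eq_biSpan_dual, hdual] at hup0
    have hup : {W ∈ biSpan (M✶.delete D) 5 | b ∈ W}.ncard ≤ {Z ∈ biSpan (M✶.delete D) 6 | b ∉ Z}.ncard := hup0
    have hT2 := through_five_eq_of_two (M✶.delete D) hnl' hr' hp'' hcl2 hbP'
    have hV2 := avoid_six_eq_of_two (M✶.delete D) hnl' hr' hp'' hcl2 hbP'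
    rw [upFull_delete_parallel M✶ hpE hDP hpD, throughHat_delete_parallel M✶ hpE hDP hpD,
      throughSp_delete_parallel M✶ hpE hDP hpD] at hT2
    rw [avoidFull_delete_parallel M✶ hpE hDP hpD, avoidHat_delete_parallel M✶ hpE hDP hpD,
      avoidSp_delete_parallel M✶ hpE hDP hpD] at hV2
    rw [hT2, hV2] at hup
    rw [hq3'] at hT
    have hc : (3 : ℕ).choose 2 = 3 := by norm_num
    rw [hc] at hT
    rw [hT, hV]
    omega
  · -- `q ≥ 4`: cut to three and use the inductive hypothesis
    have hV := avoid_six_eq_of_four_le M✶ hnl hν hpE hq4 hbP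
    obtain ⟨p'', hp''⟩ : (M✶.closure {p} \ {p, p'}).Nonempty := by
      refine Set.nonempty_of_ncard_ne_zero ?_
      rw [Set.ncard_sdiff hpair (Set.toFinite _), Set.ncard_pair hp'p.symm]; omega
    have hp''P : p'' ∈ M✶.closure {p} := hp''.1
    have hp''p : p'' ≠ p := fun h => hp''.2 (by rw [h]; exact Set.mem_insert p {p'})
    have hp''p' : p'' ≠ p' := fun h => hp''.2 (by rw [h]; exact Set.mem_insert_of_mem p rfl)
    have htriple : ({p, p', p''} : Set α) ⊆ M✶.closure {p} := by
      intro x hx; rcases hx with rfl | rfl | hx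
      · exact hpP
      · exact hp'P
      · rw [Set.mem_singleton_iff] at hx; rw [hx]; exact hp''P
    have htcard : ({p, p', p''} : Set α).ncard = 3 := by
      rw [Set.ncard_insert_of_notMem (by simp [hp'p.symm, hp''p.symm]) (Set.toFinite _),
        Set.ncard_pair hp''p'.symm]
    set D := M✶.closure {p} \ {p, p', p''} with hDdef
    have hDP : D ⊆ M✶.closure {p} := Set.sdiff_subset
    have hpD : p ∉ D := fun h => h.2 (Set.mem_insert p _)
    have hDcard : D.ncard = (M✶.closure {p}).ncard - 3 := by
      rw [hDdef, Set.ncard_sdiff htriple (Set.toFinite _), htcard]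
    have hDne : D.Nonempty := Set.nonempty_of_ncard_ne_zero (by rw [hDcard]; omega)
    obtain ⟨hdual, hcard, hlt, hν', hbM, hcl⟩ := hcut D hDP hpD hDne
    obtain ⟨hnl', hr', hp3, hbP'⟩ := hfam D hDP hpD
    have hcl3 : ((M✶.delete D).closure {p}).ncard = 3 := by
      rw [hcl, hDdef, Set.sdiff_sdiff_cancel_left htriple, htcard]
    haveI : (M.contract D).Finite := Matroid.contract_finite
    have h12 : 12 ≤ (M.contract D).E.ncard := by rw [hcard, hDcard]; omega
    have hup0 := hih (M.contract D) hlt hν' h12 b hbM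
    unfold BiIndepUpAt at hup0
    rw [biIndep_eq_biSpan_dual, biIndep_eq_biSpan_dual, hdual] at hup0
    have hup : {W ∈ biSpan (M✶.delete D) 5 | b ∈ W}.ncard ≤ {Z ∈ biSpan (M✶.delete D) 6 | b ∉ Z}.ncard := hup0
    have hT3 := through_five_eq_of_three_le (M✶.delete D) hnl' hr' hp3 (by rw [hcl3]) hbP'
    have hV3 := avoid_six_eq_of_three (M✶.delete D) hnl' hr' hp3 hcl3 hbP'
    rw [hcl3, upFull_delete_parallel M✶ hpE hDP hpD, throughHat_delete_parallel M✶ hpE hDP hpD,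
      throughHat_delete_parallel M✶ hpE hDP hpD] at hT3
    rw [avoidFull_delete_parallel M✶ hpE hDP hpD, avoidHat_delete_parallel M✶ hpE hDP hpD,
      avoidHat_delete_parallel M✶ hpE hDP hpD, avoidSp_delete_parallel M✶ hpE hDP hpD] at hV3
    rw [hT3, hV3] at hup
    have hc : (3 : ℕ).choose 2 = 3 := by norm_num
    rw [hc] at hup
    -- `ḡ_3^{sp} ≤ ḡ_3`, `1 ≤ C(q,3)`, and the splitting of `q` and `C(q,2)`
    have hsp : (avoidSp M✶ p b 3).ncard ≤ (avoidHat M✶ p b 3).ncard :=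
      Set.ncard_le_ncard (avoidSp_subset_avoidHat M✶ p b 3) (avoidHat_finite M✶ p b 3)
    have hq3c : 1 ≤ (M✶.closure {p}).ncard.choose 3 := by
      have : 1 ≤ (3 : ℕ).choose 3 := by norm_num
      exact this.trans (Nat.choose_le_choose 3 (by omega))
    have hq2c : 3 ≤ (M✶.closure {p}).ncard.choose 2 := by
      have : 3 ≤ (3 : ℕ).choose 2 := by norm_num
      exact this.trans (Nat.choose_le_choose 2 (by omega))
    obtain ⟨q₃, hq₃⟩ : ∃ q₃, (M✶.closure {p}).ncard = q₃ + 3 := ⟨(M✶.closure {p}).ncard - 3, by omega⟩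
    obtain ⟨c₃, hc₃⟩ : ∃ c₃, (M✶.closure {p}).ncard.choose 2 = c₃ + 3 :=
      ⟨(M✶.closure {p}).ncard.choose 2 - 3, by omega⟩
    have hm1 : q₃ * (throughHat M✶ p b 4).ncard ≤ q₃ * (avoidHat M✶ p b 5).ncard := Nat.mul_le_mul_left q₃ hg4
    have hm2 : c₃ * (throughHat M✶ p b 3).ncard ≤ c₃ * (avoidHat M✶ p b 4).ncard := Nat.mul_le_mul_left c₃ hg3
    have hm3 : 1 * (avoidHat M✶ p b 3).ncard ≤ (M✶.closure {p}).ncard.choose 3 * (avoidHat M✶ p b 3).ncard :=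
      Nat.mul_le_mul_right _ hq3c
    rw [hc₃, hq₃] at hT hV
    rw [hq₃] at hm3
    rw [hT, hV]
    simp only [Nat.add_mul, Nat.one_mul] at hm3 ⊢
    omega

end PercRepro
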